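import Literature.AlgebraicGeometry.Resolution.ResolutionSurfacesOfEmbeddedProjective
import Literature.AlgebraicGeometry.Resolution.ProjectiveSpaceExcellent
import Literature.AlgebraicGeometry.Resolution.ProjectiveSpaceRegular
import Literature.AlgebraicGeometry.Resolution.PrincipalizationToResolution
import Literature.AlgebraicGeometry.Resolution.SigmaMaxEliminationInDim
import Mathlib.AlgebraicGeometry.AffineSpace
import Mathlib.RingTheory.MvPolynomial.Ideal
import Mathlib.RingTheory.Ideal.KrullsHeightTheorem
import HarnessLib

/-!
# A codimension-two closed immersion of `ℙⁿ_k` into a regular excellent scheme: the zero section of `𝔸²`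

Topic: `Literature/AlgebraicGeometry/Resolution` (proofs only: no new notions, no new named facts).

The one geometric input `hP` of `cossartJannsenSaito2020_of_embedded_of_reembedding`
(`ResolutionSurfacesOfEmbeddedProjective.lean`): every projective space `ℙⁿ_k` admits a closed immersion `j` into a
Noetherian regular excellent scheme `Z` with `dim 𝒪_{Z, j(x)} ≥ 2` for all `x`.  We take `Z = 𝔸²_{ℙⁿ_k}` (Mathlib's
`AffineSpace (Fin 2)` over `ℙⁿ_k`) and `j` the zero section: a section of the (affine, hence separated) projection
is a closed immersion; `𝔸²` over a regular (resp. excellent, Noetherian) scheme is regular (resp. excellent,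
Noetherian); and over an affine open `Spec A ∋ x` of `ℙⁿ_k` the point `j(x)` of `𝔸²_A = Spec A[y₁, y₂]` is a prime
containing `y₁, y₂`, hence of height `≥ 2` (the chain `0 < ker(y₁ ↦ 0) < ker(y ↦ 0)`), which is the dimension of
the local ring.

* `exists_reembedding_projectiveSpace_codim_two` — the statement `hP`;
* `cossartJannsenSaito2020_of_embedded` — **CJS Thm. 1.2 over fields from CJS Thm. 1.4 (`B = ∅`) alone**
  (`CossartJannsenSaito2020Embedded → CossartJannsenSaito2020`).

## Sources

* V. Cossart, U. Jannsen, S. Saito, LNM 2270 (2020), Thm. 1.2, Thm. 1.4. [CossartJannsenSaito2020]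
* R. Hartshorne, *Algebraic Geometry*, II Ex. 3.20 / II.8 (dimension of local rings of 𝔸ⁿ over a variety).
  [Hartshorne1977]
-/

noncomputable section

open CategoryTheory CategoryTheory.Limits AlgebraicGeometry TopologicalSpace IsLocalRing

namespace Literature.AlgebraicGeometry.Resolution

universe u

/-! ## Primes of `A[y₁, y₂]` containing `y₁, y₂` have height `≥ 2` -/

/-- In `A[y₁, y₂]` over a domain `A`, a prime ideal containing `y₁` and `y₂` has height `≥ 2`: it contains the
chain `0 < ker (y₁ ↦ 0, y₂ ↦ y₂) < ker (constant coefficient)`. [folklore] -/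
private theorem two_le_height_of_X_mem {A : Type u} [CommRing A] [IsDomain A] [IsNoetherianRing A]
    (Q : Ideal (MvPolynomial (Fin 2) A)) [Q.IsPrime]
    (h0 : MvPolynomial.X 0 ∈ Q) (h1 : MvPolynomial.X 1 ∈ Q) : (2 : ℕ∞) ≤ Q.height := by
  classical
  let φ₁ : MvPolynomial (Fin 2) A →ₐ[A] MvPolynomial (Fin 2) A :=
    MvPolynomial.aeval fun i => if i = 0 then 0 else MvPolynomial.X i
  let cc : MvPolynomial (Fin 2) A →+* A := MvPolynomial.constantCoeff
  let 𝔭₁ : Ideal (MvPolynomial (Fin 2) A) := RingHom.ker φ₁.toRingHom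
  let 𝔭₂ : Ideal (MvPolynomial (Fin 2) A) := RingHom.ker cc
  haveI : 𝔭₁.IsPrime := RingHom.ker_isPrime _
  haveI : 𝔭₂.IsPrime := RingHom.ker_isPrime _
  have hccφ : ∀ f, cc (φ₁ f) = cc f := by
    intro f
    have : cc.comp φ₁.toRingHom = cc := by
      apply MvPolynomial.ringHom_ext
      · intro a
        simp [cc, φ₁]
      · intro i
        fin_cases i <;> simp [cc, φ₁]
    exact congrArg (fun g : MvPolynomial (Fin 2) A →+* A => g f) this
  have h12 : 𝔭₁ < 𝔭₂ := by
    refine lt_of_le_of_ne (fun f hf => ?_) (fun h => ?_)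
    · change cc f = 0
      rw [← hccφ f, show φ₁ f = 0 from hf, map_zero]
    · have hX1 : (MvPolynomial.X 1 : MvPolynomial (Fin 2) A) ∈ 𝔭₂ := by
        change cc (MvPolynomial.X 1) = 0
        simp [cc]
      rw [← h] at hX1
      have : φ₁ (MvPolynomial.X 1) = 0 := hX1
      simp [φ₁] at this
  have h01 : (⊥ : Ideal (MvPolynomial (Fin 2) A)) < 𝔭₁ := by
    refine bot_lt_iff_ne_bot.mpr fun h => ?_
    have hX0 : (MvPolynomial.X 0 : MvPolynomial (Fin 2) A) ∈ 𝔭₁ := by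
      change φ₁ (MvPolynomial.X 0) = 0
      simp [φ₁]
    rw [h] at hX0
    exact MvPolynomial.X_ne_zero _ ((Submodule.mem_bot _).mp hX0)
  have h2Q : 𝔭₂ ≤ Q := by
    intro f hf
    have hf0 : cc f = 0 := hf
    have hspan : f ∈ Ideal.span (MvPolynomial.X '' (Set.univ : Set (Fin 2)) :
        Set (MvPolynomial (Fin 2) A)) := by
      rw [MvPolynomial.mem_ideal_span_X_image]
      intro m hm
      by_contra hcon
      push Not at hcon
      have hm0 : m = 0 := by
        ext i
        simpa using hcon i (Set.mem_univ i)
      rw [hm0] at hm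
      have : MvPolynomial.coeff 0 f ≠ 0 := MvPolynomial.mem_support_iff.mp hm
      exact this (by simpa [cc, MvPolynomial.constantCoeff_eq] using hf0)
    refine (Ideal.span_le.mpr ?_) hspan
    rintro _ ⟨i, -, rfl⟩
    fin_cases i
    · exact h0
    · exact h1
  have a1 := Ideal.height_strict_mono_of_isPrime h01
  have a2 := Ideal.height_strict_mono_of_isPrime h12
  rw [Ideal.height_bot] at a1
  have b1 : (1 : ℕ∞) ≤ 𝔭₁.height := Order.one_le_iff_ne_zero.mpr a1.ne'
  have b2 : 𝔭₁.height + 1 ≤ 𝔭₂.height := Order.add_one_le_of_lt a2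
  have b3 : (1 : ℕ∞) + 1 ≤ 𝔭₂.height := le_trans (by gcongr) b2
  exact b3.trans (Ideal.height_mono h2Q)

/-! ## The zero section of `𝔸²` over an affine scheme: coordinates vanish -/

/-- Over an affine `S`, the image under `𝔸²_S ≅ Spec Γ(S)[y₁, y₂]` of a point of the zero section is a prime
containing the variables. [folklore] -/
private theorem X_mem_asIdeal_zeroSection {S : Scheme.{0}} [IsAffine S] (x : S) (i : Fin 2) :
    MvPolynomial.X i ∈ ((AffineSpace.homOfVector (𝟙 S) (0 : Fin 2 → Γ(S, ⊤)) ≫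
      (AffineSpace.isoOfIsAffine (Fin 2) S).hom) x).asIdeal := by
  set g := AffineSpace.homOfVector (𝟙 S) (0 : Fin 2 → Γ(S, ⊤)) ≫
    (AffineSpace.isoOfIsAffine (Fin 2) S).hom with hg
  by_contra hnot
  have hhom : (Scheme.ΓSpecIso (.of (MvPolynomial (Fin 2) Γ(S, ⊤)))).hom
      ((Scheme.ΓSpecIso (.of (MvPolynomial (Fin 2) Γ(S, ⊤)))).inv (MvPolynomial.X i)) =
      MvPolynomial.X i := Iso.inv_hom_id_apply _ _
  have hx : x ∈ g ⁻¹ᵁ ((Spec (.of (MvPolynomial (Fin 2) Γ(S, ⊤)))).basicOpen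
      ((Scheme.ΓSpecIso (.of (MvPolynomial (Fin 2) Γ(S, ⊤)))).inv (MvPolynomial.X i))) := by
    change g x ∈ (Spec (.of (MvPolynomial (Fin 2) Γ(S, ⊤)))).basicOpen
      ((Scheme.ΓSpecIso (.of (MvPolynomial (Fin 2) Γ(S, ⊤)))).inv (MvPolynomial.X i))
    rw [basicOpen_eq_of_affine', hhom]
    exact (PrimeSpectrum.mem_basicOpen _ _).mpr hnot
  rw [Scheme.preimage_basicOpen_top] at hx
  have happ : g.appTop ((Scheme.ΓSpecIso (.of (MvPolynomial (Fin 2) Γ(S, ⊤)))).inv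
      (MvPolynomial.X i)) = 0 := by
    rw [hg, Scheme.Hom.comp_appTop, CommRingCat.comp_apply, AffineSpace.isoOfIsAffine_hom_appTop,
      CommRingCat.comp_apply]
    rw [hhom]
    change (AffineSpace.homOfVector (𝟙 S) (0 : Fin 2 → Γ(S, ⊤))).appTop
      (MvPolynomial.eval₂Hom ((𝔸(Fin 2; S) ↘ S).appTop).hom (AffineSpace.coord S) (MvPolynomial.X i)) = 0
    rw [MvPolynomial.coe_eval₂Hom, MvPolynomial.eval₂_X, AffineSpace.homOfVector_appTop_coord]
    rfl
  rw [happ, Scheme.basicOpen_zero] at hx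
  exact hx

/-! ## The re-embedding -/

/-- **`hP`: every `ℙⁿ_k` has a closed immersion of codimension `≥ 2` into a Noetherian regular excellent scheme**
— the zero section `j` of `𝔸²_{ℙⁿ_k} → ℙⁿ_k`: a section of a separated morphism is a closed immersion; `𝔸²` over
`ℙⁿ_k` is Noetherian, regular (`Scheme.IsRegular.affineSpace`) and excellent (finite type over an excellent
scheme); and `dim 𝒪_{𝔸², j(x)} ≥ 2`, computed on an affine chart `Spec A ∋ x` where `j(x)` is a prime of
`A[y₁, y₂]` containing `y₁, y₂`. [cite: Hartshorne1977, II Ex. 3.20] -/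
theorem exists_reembedding_projectiveSpace_codim_two (n : ℕ) (k : Type) [Field k] :
    ∃ (Z : Scheme.{0}) (j : (Motives.projectiveSpace n k).left ⟶ Z),
      IsClosedImmersion j ∧ IsNoetherian Z ∧ Scheme.IsRegular Z ∧ Scheme.IsExcellent Z ∧
        ∀ x, (2 : WithBot ℕ∞) ≤ ringKrullDim (Z.presheaf.stalk (j x)) := by
  set P := (Motives.projectiveSpace n k).left with hP
  haveI : IsNoetherian P := ProjectiveSpace.isNoetherian_projectiveSpace n k
  haveI : IsIntegral P := isIntegral_projectiveSpace n k
  let j : P ⟶ 𝔸(Fin 2; P) := AffineSpace.homOfVector (𝟙 P) (0 : Fin 2 → Γ(P, ⊤))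
  have hjπ : j ≫ (𝔸(Fin 2; P) ↘ P) = 𝟙 P := AffineSpace.homOfVector_over _ _
  -- Noetherian, regular, excellent
  haveI : IsLocallyNoetherian 𝔸(Fin 2; P) :=
    LocallyOfFiniteType.isLocallyNoetherian (𝔸(Fin 2; P) ↘ P)
  haveI : CompactSpace 𝔸(Fin 2; P) := QuasiCompact.compactSpace_of_compactSpace (𝔸(Fin 2; P) ↘ P)
  haveI : IsNoetherian 𝔸(Fin 2; P) := {}
  have hreg : Scheme.IsRegular 𝔸(Fin 2; P) :=
    Scheme.IsRegular.affineSpace (Fin 2) (isRegular_projectiveSpace n k)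
  have hexc : Scheme.IsExcellent 𝔸(Fin 2; P) :=
    Scheme.IsExcellent.of_locallyOfFiniteType (𝔸(Fin 2; P) ↘ P)
      (ProjectiveSpace.isExcellent_projectiveSpace n k)
  -- closed immersion
  haveI : IsSeparated (𝔸(Fin 2; P) ↘ P) := IsSeparated.of_isAffineHom _
  haveI : IsClosedImmersion j := by
    have : IsClosedImmersion (j ≫ (𝔸(Fin 2; P) ↘ P)) := by rw [hjπ]; infer_instance
    exact MorphismProperty.of_postcomp (W := @IsClosedImmersion) (W' := @IsSeparated)
      j (𝔸(Fin 2; P) ↘ P) inferInstance this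
  refine ⟨𝔸(Fin 2; P), j, inferInstance, inferInstance, hreg, hexc, fun x => ?_⟩
  -- an affine open `U ∋ x` and the chart `𝔸²_U ↪ 𝔸²_P`
  obtain ⟨U, hxU⟩ : ∃ U : P.affineOpens, x ∈ (U : P.Opens) := by
    obtain ⟨_, ⟨U, hU, rfl⟩, hxU, -⟩ :=
      P.isBasis_affineOpens.exists_subset_of_mem_open (Set.mem_univ x) isOpen_univ
    exact ⟨⟨U, hU⟩, hxU⟩
  haveI : IsAffine (U : Scheme.{0}) := U.2
  haveI : Nonempty (U : Scheme.{0}) := ⟨⟨x, hxU⟩⟩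
  haveI : IsIntegral (U : Scheme.{0}) := isIntegral_of_isOpenImmersion (U : P.Opens).ι
  let jU : (U : Scheme.{0}) ⟶ 𝔸(Fin 2; (U : Scheme.{0})) :=
    AffineSpace.homOfVector (𝟙 _) (0 : Fin 2 → Γ((U : Scheme.{0}), ⊤))
  let m : 𝔸(Fin 2; (U : Scheme.{0})) ⟶ 𝔸(Fin 2; P) := AffineSpace.map (Fin 2) (U : P.Opens).ι
  haveI : IsOpenImmersion m :=
    MorphismProperty.IsStableUnderBaseChange.of_isPullback
      (AffineSpace.isPullback_map (n := Fin 2) (U : P.Opens).ι).flip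
      (inferInstance : IsOpenImmersion (U : P.Opens).ι)
  -- `j x = m (jU x')`
  have hcomm : jU ≫ m = (U : P.Opens).ι ≫ j := by
    apply AffineSpace.hom_ext
    · rw [Category.assoc, AffineSpace.map_over, ← Category.assoc, AffineSpace.homOfVector_over,
        Category.id_comp, Category.assoc, hjπ, Category.comp_id]
    · intro i
      rw [Scheme.Hom.comp_appTop, Scheme.Hom.comp_appTop, CommRingCat.comp_apply, CommRingCat.comp_apply,
        AffineSpace.map_appTop_coord, AffineSpace.homOfVector_appTop_coord,
        AffineSpace.homOfVector_appTop_coord]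
      simp
  have hjx : j x = m (jU ⟨x, hxU⟩) := by
    have h := congrArg (fun φ : ((U : Scheme.{0}) ⟶ 𝔸(Fin 2; P)) => φ ⟨x, hxU⟩) hcomm
    simp only [Scheme.Hom.comp_apply] at h
    exact h.symm
  -- stalks: `𝒪_{𝔸²_P, j x} ≅ 𝒪_{𝔸²_U, jU x'} ≅ 𝒪_{Spec A[y], y} ≅ A[y]_Q`
  set x' : (U : Scheme.{0}) := ⟨x, hxU⟩
  let e := AffineSpace.isoOfIsAffine (Fin 2) (U : Scheme.{0})
  set y := e.hom (jU x') with hy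
  have e1 : (𝔸(Fin 2; P)).presheaf.stalk (j x) ≃+* (𝔸(Fin 2; (U : Scheme.{0}))).presheaf.stalk (jU x') := by
    rw [hjx]
    exact (asIso (m.stalkMap (jU x'))).commRingCatIsoToRingEquiv
  have e2 : (Spec (.of (MvPolynomial (Fin 2) Γ((U : Scheme.{0}), ⊤)))).presheaf.stalk y ≃+*
      (𝔸(Fin 2; (U : Scheme.{0}))).presheaf.stalk (jU x') := by
    have h := (asIso (e.hom.stalkMap (jU x'))).commRingCatIsoToRingEquiv
    exact h
  have e3 : Localization.AtPrime y.asIdeal ≃+*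
      (Spec (.of (MvPolynomial (Fin 2) Γ((U : Scheme.{0}), ⊤)))).presheaf.stalk y :=
    (StructureSheaf.stalkIso _ y).toRingEquiv
  rw [ringKrullDim_eq_of_ringEquiv e1, ← ringKrullDim_eq_of_ringEquiv e2, ← ringKrullDim_eq_of_ringEquiv e3,
    IsLocalization.AtPrime.ringKrullDim_eq_height y.asIdeal (Localization.AtPrime y.asIdeal)]
  have h0 := X_mem_asIdeal_zeroSection (S := (U : Scheme.{0})) x' 0
  have h1 := X_mem_asIdeal_zeroSection (S := (U : Scheme.{0})) x' 1
  haveI : IsNoetherianRing Γ((U : Scheme.{0}), ⊤) :=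
    IsLocallyNoetherian.component_noetherian ⟨⊤, isAffineOpen_top _⟩
  have h2 : (2 : ℕ∞) ≤ y.asIdeal.height := two_le_height_of_X_mem y.asIdeal h0 h1
  exact (WithBot.coe_le_coe (a := (2 : ℕ∞))).mpr h2

/-- **Cossart–Jannsen–Saito Thm. 1.2 over fields from Thm. 1.4 (`B = ∅`) ALONE**: resolution of every reduced
separated scheme of finite type of dimension `≤ 2` over every field (`CossartJannsenSaito2020`, the weak form used
by Cossart–Piltant 2019) follows from the embedded theorem `CossartJannsenSaito2020Embedded`
(`cossartJannsenSaito2020_of_embedded_of_reembedding` with `exists_reembedding_projectiveSpace_codim_two`).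
[cite: CossartJannsenSaito2020, Thm. 1.2 and Thm. 1.4] -/
theorem cossartJannsenSaito2020_of_embedded (hCJSE : CossartJannsenSaito2020Embedded.{0}) :
    CossartJannsenSaito2020.{0} :=
  cossartJannsenSaito2020_of_embedded_of_reembedding hCJSE fun n k _ =>
    exists_reembedding_projectiveSpace_codim_two n k

end Literature.AlgebraicGeometry.Resolution

end
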